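import Summits.AnomalousDissipation.AnomalousDissipation.Theses.TwoAndHalfD
import Literature.Analysis.FluidPDE.TwoHalfNavierStokes
import Literature.Analysis.FluidPDE.PassiveScalarForced
import Literature.Analysis.FluidPDE.TwoHalfSection
import Literature.Analysis.FluidPDE.TwoHalfSpectralSplit
import Literature.Analysis.FluidPDE.LerayHopfDatumRebase

/-!
# The planar section of an `x₃`-invariant `H¹` datum is an honest `H¹` datum of the planar
# Leray–Hopf section  (stub stub_sectionDatumH1 of the line `log-kantorovich-enstrophy-transfer`,
# crux `TwoAndHalfD.TwohalfdNeg`, stmt-AnomalousDissipation-0211) — CORRECTED FORM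

Let `u` be a global Leray–Hopf solution on `T³` from an `x₃`-invariant datum `u₀ ∈ L²` with
`‖∇u₀‖₂ < ∞` (`Torus.eGradNormSq u₀ < ⊤`), let `u t = twoHalf (v t) (θ t)` for `t ≠ 0`, and let `v`
be a global Leray–Hopf solution of the planar system from SOME datum `v₀`. Then the planar section
`V` of `u₀ = twoHalf V R` (`Torus.eq_twoHalf_of_forall_add_single'`) satisfies `V ∈ L²`,
`‖∇V‖₂ < ∞` (`Torus.memLp_of_twoHalf`, `Torus.eGradNormSq_left_le_twoHalf`), `v` is ALSO a global
Leray–Hopf solution from `V` — since `‖v t - V‖₂ ≤ ‖u t - u₀‖₂ → 0` (`Torus.eLpNorm_left_le_twoHalf`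
and the strong initial trace of `u`) and a strong `L²` trace is a datum
(`Torus.IsGlobalLerayHopf.congr_datum_of_tendsto`, `LerayHopfDatumRebase`) — and `v₀ = V` a.e.
whenever `v₀` is a.e. strongly measurable (`Torus.IsGlobalLerayHopf.datum_ae_eq_of_tendsto`).

The registered form (conclusion `MemLp v₀ 2 volume ∧ Torus.eGradNormSq v₀ < ⊤` with no
measurability of `v₀`) is false: the datum of `Torus.IsLerayHopfOn` is seen only through
junk-valued Bochner pairings, the kinetic energy and a lower integral (`LerayHopfDatumTorus`), so
`u = 0, u₀ = 0, v = 0, θ = 0, f = g = 0, v₀ = 1_A • e` with `A ⊆ T²` of inner measure `0` and full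
outer measure satisfies every hypothesis while `v₀` is not a.e. strongly measurable. [folklore];
Majda–Bertozzi 2002, §2.3.1; Galdi 2000, Def. 2.1 (iv).
-/

namespace Summit.AnomalousDissipation.AnomalousDissipation.Theorems.TwohalfdNeg.SectionDatumH1

open MeasureTheory Filter Topology
open scoped ENNReal NNReal
open Literature.Analysis.FunctionSpaces Literature.Analysis.FluidPDE

set_option linter.dupNamespace false

/-- **S6-co/C′ (corrected form): the planar section of the `x₃`-invariant `H¹` datum is an honest
`H¹` datum of the planar Leray–Hopf section.** If `u` is a global Leray–Hopf solution on `T³` from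
an `x₃`-invariant `u₀ ∈ L²` with `eGradNormSq u₀ < ⊤`, `u t = twoHalf (v t) (θ t)` for `t ≠ 0`, and
`v` is a global Leray–Hopf solution from `v₀`, then there is `V ∈ L²(T²)` with `eGradNormSq V < ⊤`
such that `v` is a global Leray–Hopf solution from `V`, and `v₀ = V` a.e. if `v₀` is a.e. strongly
measurable (`V` = planar section of `u₀`; `‖v t - V‖₂ ≤ ‖u t - u₀‖₂ → 0`, then
`Torus.IsGlobalLerayHopf.congr_datum_of_tendsto` / `datum_ae_eq_of_tendsto`). [folklore] -/
theorem stub_sectionDatumH1 :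
    ∀ (ν : ℝ) (f : UnitAddTorus (Fin 3) → EuclideanSpace ℝ (Fin 3))
      (u₀ : UnitAddTorus (Fin 3) → EuclideanSpace ℝ (Fin 3)) (u : ℝ → UnitAddTorus (Fin 3) → EuclideanSpace ℝ (Fin 3))
      (g : UnitAddTorus (Fin 2) → EuclideanSpace ℝ (Fin 2))
      (v₀ : UnitAddTorus (Fin 2) → EuclideanSpace ℝ (Fin 2)) (v : ℝ → UnitAddTorus (Fin 2) → EuclideanSpace ℝ (Fin 2))
      (θ : ℝ → UnitAddTorus (Fin 2) → ℝ),
      Torus.IsGlobalLerayHopf ν (fun _ => f) u₀ u →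
      (∀ (s : UnitAddCircle) (x : UnitAddTorus (Fin 3)), u₀ (x + Pi.single (2 : Fin 3) s) = u₀ x) →
      MemLp u₀ 2 volume → Torus.eGradNormSq u₀ < ⊤ →
      (∀ t : ℝ, t ≠ 0 → u t = Torus.twoHalf (v t) (θ t)) →
      Torus.IsGlobalLerayHopf ν (fun _ => g) v₀ v →
      ∃ V : UnitAddTorus (Fin 2) → EuclideanSpace ℝ (Fin 2),
        MemLp V 2 volume ∧ Torus.eGradNormSq V < ⊤ ∧ Torus.IsGlobalLerayHopf ν (fun _ => g) V v ∧
        (AEStronglyMeasurable v₀ volume → v₀ =ᵐ[volume] V) := by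
  intro ν f u₀ u g v₀ v θ hu hinv hu₀ hH1 hsplit hv
  -- the planar and vertical sections of the invariant datum
  obtain ⟨V, R, hVR⟩ : ∃ (V : UnitAddTorus (Fin 2) → EuclideanSpace ℝ (Fin 2)) (R : UnitAddTorus (Fin 2) → ℝ),
      u₀ = Torus.twoHalf V R := ⟨_, _, Torus.eq_twoHalf_of_forall_add_single' hinv⟩
  have hVR2 : MemLp (Torus.twoHalf V R) 2 volume := hVR ▸ hu₀
  obtain ⟨hV2, hR2⟩ := Torus.memLp_of_twoHalf hVR2
  have hVH1 : Torus.eGradNormSq V < ⊤ := by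
    refine lt_of_le_of_lt (Torus.eGradNormSq_left_le_twoHalf (hV2.integrable one_le_two) (hR2.integrable one_le_two)) ?_
    rw [← hVR]
    exact hH1
  -- the planar section of the strong initial trace of `u`: `‖v t - V‖₂ ≤ ‖u t - u₀‖₂ → 0`
  have hlim : Tendsto (fun t => eLpNorm (v t - V) 2 volume) (𝓝[>] 0) (𝓝 0) := by
    refine tendsto_of_tendsto_of_tendsto_of_le_of_le' tendsto_const_nhds (hu 1 one_pos).strong_initial
      (Eventually.of_forall fun _ => zero_le) ?_
    filter_upwards [Ioo_mem_nhdsGT (zero_lt_one' ℝ)] with t ht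
    have hvt : AEStronglyMeasurable (v t) volume := ((hv 1 one_pos).memLp t (Set.Ioo_subset_Icc_self ht)).1
    calc eLpNorm (v t - V) 2 volume ≤ eLpNorm (Torus.twoHalf (v t - V) (θ t - R)) 2 volume :=
          Torus.eLpNorm_left_le_twoHalf (hvt.sub hV2.1) (θ t - R) 2
      _ = eLpNorm (u t - u₀) 2 volume := by
          rw [Torus.twoHalf_sub, ← hsplit t (ne_of_gt ht.1), ← hVR]
  exact ⟨V, hV2, hVH1, hv.congr_datum_of_tendsto hV2 hlim, fun hm => hv.datum_ae_eq_of_tendsto hm hV2.1 hlim⟩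

end Summit.AnomalousDissipation.AnomalousDissipation.Theorems.TwohalfdNeg.SectionDatumH1
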